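import Literature.MathematicalPhysics.QuantumFieldTheory.Balaban1983to89.Beta.AffineAveraging
import Literature.MathematicalPhysics.QuantumFieldTheory.Balaban1983to89.Beta.OneBlockTorusKKT
import Literature.MathematicalPhysics.QuantumFieldTheory.BlochPeriodicCochains

/-!
# Periodic descent: block-periodic lattice fields on `ℤ^d` versus fields on the one-block torus `(ℤ/Nℤ)^d`

HONEST FRAMING (binding, verbatim): "discharging BetaPertH makes Balaban's UV stability UNCONDITIONAL — a real
constructive-QFT result; it is NOT the continuum limit and NOT the Clay problem."  This module is NOT summit progress.

WHAT THIS FILE IS.  [folklore] elementary lattice bookkeeping, the kernel-routine step (B3-loc) of HOME/BETA/AN2.md §11 (Y15):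
the dictionary between `N`-PERIODIC fields on `ℤ^d` (the setting of `Beta.AffineAveraging`: `Site d = Fin d → ℤ`, stencils
`dz`, `curv`, `curvAdj`, `codiff₁`, block / straight-contour sums `blockSum`, `contourSum`) and fields on the one-block torus
`𝕋 d N = Fin d → ZMod N` (the setting of `Beta.OneBlockTorusKKT`), along the projection `Torus.proj N : ℤ^d → (ℤ/Nℤ)^d`
(transport lemmas `repZ`, `proj_repZ`, `proj_add_e`, `exists_eq_add_zsmul_of_proj_eq` of `BlochPeriodicCochains` reused, not re-proved).
* §1 projection algebra (`proj_add`, `proj_zsmul`, `proj_unitVec`, `proj_nsmul_site_eq_zero`, `proj_blockPoint`);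
* §2 LIFTS `lift0/lift1/lift2` of torus fields to periodic lattice fields, and `IsPeriodic`; every periodic field is a lift
  (`eq_lift0_of_isPeriodic`);
* §3 the finite stencils COMMUTE with lifting: `dz_lift0`, `curv_lift1`, `codiff₁_lift1`, `curvAdj_lift2` — on the torus side the
  stencils are written by the same formulas with `e κ = Pi.single κ 1` (literally `OneBlockTorusKKT.d0_apply` / `d1_apply`);
* §4 block sums of lifts are torus totals: `sum_box_proj` (the offsets `b ∈ box d N` parametrise the torus bijectively),
  `blockSum_lift0` (`blockSum N (lift0 u) y = Σ_z u z`, independent of the block `y`), `contourSum_lift1`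
  (`contourSum N (lift1 D) κ y = Σ_z Σ_{s<N} D κ (z + s • e κ)` = the formula of `OneBlockTorusKKT.Q`);
* §5 (B3-loc)(i): a lattice field whose GRADIENT is `N`-periodic is an `N`-periodic field plus a `ℤ`-LINEAR one
  (`const_of_dz_eq_zero`: `dz g = 0 → g x = g 0` on `ℤ^d`; `exists_periodic_add_linear_of_dz_periodic`).
Nothing of Bałaban's manuscripts is asserted; CONTEXT locator for the averaging block / straight contours:
[Balaban1984PropagatorsI] p. 19 (1.11); for the block-periodic (k ≡ 0) sector: [Balaban1985BackgroundPropagators] p. 394 (3.21).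
-/

namespace Literature.MathematicalPhysics.QuantumFieldTheory.Balaban1983to89.Beta.PeriodicDescent

open Literature.Probability.LatticeModels (TorusSite Torus.proj Torus.proj_apply)
open AffineAveraging (Form0 Form1 Form2 unitVec dz curv curvAdj codiff₁ box toSite blockSum contourSum)
open OneBlockTorusKKT (𝕋 e)
open LatticeForm (repZ proj_repZ proj_add_zsmul exists_eq_add_zsmul_of_proj_eq)

variable {d N : ℕ}

/-! ## §1 Projection algebra -/

/-- `Torus.proj` is additive. [folklore] -/
theorem proj_add (x y : AffineAveraging.Site d) : Torus.proj N (x + y) = Torus.proj N x + Torus.proj N y := by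
  funext j; simp [Torus.proj_apply]

/-- `Torus.proj` of a negation. [folklore] -/
theorem proj_neg (x : AffineAveraging.Site d) : Torus.proj N (-x) = -Torus.proj N x := by
  funext j; simp [Torus.proj_apply]

/-- `Torus.proj` of a difference. [folklore] -/
theorem proj_sub (x y : AffineAveraging.Site d) : Torus.proj N (x - y) = Torus.proj N x - Torus.proj N y := by
  rw [sub_eq_add_neg, proj_add, proj_neg, ← sub_eq_add_neg]

/-- `Torus.proj` commutes with integer scalar multiplication. [folklore] -/
theorem proj_zsmul (n : ℤ) (x : AffineAveraging.Site d) : Torus.proj N (n • x) = n • Torus.proj N x := by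
  funext j; simp [Torus.proj_apply]

/-- The unit vector projects to the torus unit vector `e κ = Pi.single κ 1`. [folklore] -/
theorem proj_unitVec (κ : Fin d) : Torus.proj N (unitVec κ) = (e κ : 𝕋 d N) := by
  funext j
  by_cases hj : j = κ
  · subst hj; simp [Torus.proj_apply, unitVec, e]
  · simp [Torus.proj_apply, unitVec, e, Pi.single_eq_of_ne hj]

/-- Block translations are invisible on the torus: `proj (N • y) = 0`. [folklore] -/
theorem proj_nsmul_site_eq_zero (y : AffineAveraging.Site d) : Torus.proj N ((N : ℤ) • y) = 0 := by
  funext j; simp [Torus.proj_apply]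

/-- The point `N • y + b + s • e_κ` of a block projects to `proj b + s • e κ`. [folklore] -/
theorem proj_blockPoint (y b : AffineAveraging.Site d) (s : ℤ) (κ : Fin d) :
    Torus.proj N ((N : ℤ) • y + b + s • unitVec κ) = Torus.proj N b + s • (e κ : 𝕋 d N) := by
  rw [proj_add, proj_add, proj_nsmul_site_eq_zero, zero_add, proj_zsmul, proj_unitVec]

/-! ## §2 Lifts and periodic fields -/

/-- Lift of a torus 0-cochain to an `N`-periodic lattice field. [folklore] -/
def lift0 (N : ℕ) (u : 𝕋 d N → ℝ) : Form0 d ℝ := fun x => u (Torus.proj N x)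

/-- Lift of a torus 1-cochain (direction first). [folklore] -/
def lift1 (N : ℕ) (D : Fin d → 𝕋 d N → ℝ) : Form1 d ℝ := fun κ x => D κ (Torus.proj N x)

/-- Lift of a torus 2-cochain. [folklore] -/
def lift2 (N : ℕ) (F : Fin d → Fin d → 𝕋 d N → ℝ) : Form2 d ℝ := fun κ l x => F κ l (Torus.proj N x)

/-- Values of `lift0`. [folklore] -/
@[simp] theorem lift0_apply (u : 𝕋 d N → ℝ) (x : AffineAveraging.Site d) : lift0 N u x = u (Torus.proj N x) := rfl
/-- Values of `lift1`. [folklore] -/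
@[simp] theorem lift1_apply (D : Fin d → 𝕋 d N → ℝ) (κ : Fin d) (x : AffineAveraging.Site d) :
    lift1 N D κ x = D κ (Torus.proj N x) := rfl
/-- Values of `lift2`. [folklore] -/
@[simp] theorem lift2_apply (F : Fin d → Fin d → 𝕋 d N → ℝ) (κ l : Fin d) (x : AffineAveraging.Site d) :
    lift2 N F κ l x = F κ l (Torus.proj N x) := rfl

/-- `N`-periodicity of a lattice field (invariance under the block lattice `N • ℤ^d`). [folklore] -/
def IsPeriodic (N : ℕ) (f : Form0 d ℝ) : Prop := ∀ x a : AffineAveraging.Site d, f (x + (N : ℤ) • a) = f x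

/-- Lifts are periodic. [folklore] -/
theorem isPeriodic_lift0 (u : 𝕋 d N → ℝ) : IsPeriodic N (lift0 N u) := by
  intro x a
  simp only [lift0_apply, proj_add_zsmul]

/-- Every periodic field is the lift of its restriction along integer representatives. [folklore] -/
theorem eq_lift0_of_isPeriodic [NeZero N] (f : Form0 d ℝ) (hf : IsPeriodic N f) :
    f = lift0 N (fun z => f (repZ z)) := by
  funext x
  simp only [lift0_apply]
  have h : Torus.proj N (repZ (Torus.proj N x)) = Torus.proj N x := proj_repZ _
  obtain ⟨a, ha⟩ := exists_eq_add_zsmul_of_proj_eq h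
  have key : f (repZ (Torus.proj N x) + (N : ℤ) • a) = f (repZ (Torus.proj N x)) := hf _ _
  rw [← ha] at key
  exact key

/-! ## §3 The finite stencils commute with lifting -/

/-- Gradient of a lift = lift of the torus gradient. [folklore] -/
theorem dz_lift0 (u : 𝕋 d N → ℝ) :
    dz (lift0 N u) = lift1 N (fun κ y => u (y + e κ) - u y) := by
  funext κ x
  simp only [dz, lift0_apply, lift1_apply, proj_add, proj_unitVec]

/-- Curvature of a lift = lift of the torus curvature (the formula of `OneBlockTorusKKT.d1_apply`). [folklore] -/
theorem curv_lift1 (D : Fin d → 𝕋 d N → ℝ) :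
    curv (lift1 N D) = lift2 N (fun κ l y => D κ y + D l (y + e κ) - D κ (y + e l) - D l y) := by
  funext κ l x
  simp only [curv, lift1_apply, lift2_apply, proj_add, proj_unitVec]

/-- Codifferential of a lift = lift of the torus codifferential. [folklore] -/
theorem codiff₁_lift1 (D : Fin d → 𝕋 d N → ℝ) :
    codiff₁ (lift1 N D) = lift0 N (fun y => ∑ κ, (D κ (y - e κ) - D κ y)) := by
  funext x
  simp only [codiff₁, lift1_apply, lift0_apply, proj_sub, proj_unitVec]

/-- Euler–Lagrange stencil of a lift = lift of the torus stencil. [folklore] -/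
theorem curvAdj_lift2 (F : Fin d → Fin d → 𝕋 d N → ℝ) :
    curvAdj (lift2 N F) = lift1 N (fun μ y =>
      (∑ l, (F μ l y - F μ l (y - e l))) + ∑ κ, (F κ μ (y - e κ) - F κ μ y)) := by
  funext μ x
  simp only [curvAdj, lift2_apply, lift1_apply, proj_sub, proj_unitVec]

/-! ## §4 Block sums of lifts are torus totals -/

/-- The offsets `b ∈ box d N` parametrise the torus bijectively: a sum over the box of a function of `proj b` is the
sum over the torus. [folklore] -/
theorem sum_box_proj [NeZero N] (g : 𝕋 d N → ℝ) :
    ∑ b ∈ box d N, g (Torus.proj N (toSite b)) = ∑ z : 𝕋 d N, g z := by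
  refine Finset.sum_nbij' (fun b => Torus.proj N (toSite b)) (fun z j => (z j).val) ?_ ?_ ?_ ?_ ?_
  · intro b _; exact Finset.mem_univ _
  · intro z _
    simp only [box, Fintype.mem_piFinset, Finset.mem_range]
    exact fun j => ZMod.val_lt (z j)
  · intro b hb
    simp only [box, Fintype.mem_piFinset, Finset.mem_range] at hb
    funext j
    simp only [Torus.proj_apply, toSite, Int.cast_natCast, ZMod.val_natCast]
    exact Nat.mod_eq_of_lt (hb j)
  · intro z _
    funext j
    simp only [Torus.proj_apply, toSite, Int.cast_natCast, ZMod.natCast_zmod_val]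
  · intro b _; rfl

/-- The block sum of a lifted 0-cochain is the torus total, the same for every block. [folklore] -/
theorem blockSum_lift0 [NeZero N] (u : 𝕋 d N → ℝ) (y : AffineAveraging.Site d) :
    blockSum N (lift0 N u) y = ∑ z : 𝕋 d N, u z := by
  simp only [blockSum, lift0_apply, proj_add, proj_nsmul_site_eq_zero, zero_add]
  exact sum_box_proj u

/-- The straight-contour block sum of a lifted 1-cochain is the torus contour total of `OneBlockTorusKKT.Q`, the same for
every block. [folklore] -/
theorem contourSum_lift1 [NeZero N] (D : Fin d → 𝕋 d N → ℝ) (κ : Fin d) (y : AffineAveraging.Site d) :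
    contourSum N (lift1 N D) κ y = ∑ z : 𝕋 d N, ∑ s ∈ Finset.range N, D κ (z + (s : ℤ) • e κ) := by
  simp only [contourSum, lift1_apply, proj_blockPoint]
  exact sum_box_proj (fun z => ∑ s ∈ Finset.range N, D κ (z + (s : ℤ) • e κ))

/-! ## §5 (B3-loc)(i): periodic gradient ⟹ periodic plus linear -/

/-- On `ℤ^d`, a field with zero gradient is constant along every lattice line. [folklore] -/
theorem apply_add_zsmul_unitVec_of_dz_eq_zero {R : Type*} [CommRing R] (g : Form0 d R) (h : dz g = 0) (κ : Fin d) :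
    ∀ (n : ℤ) (x : AffineAveraging.Site d), g (x + n • unitVec κ) = g x := by
  have step : ∀ x : AffineAveraging.Site d, g (x + unitVec κ) = g x := by
    intro x
    have hx := congrFun (congrFun h κ) x
    simp only [dz, Pi.zero_apply] at hx
    exact sub_eq_zero.1 hx
  intro n
  induction n using Int.induction_on with
  | zero => intro x; simp
  | succ n ih => intro x; rw [add_smul, one_smul, ← add_assoc, step, ih]
  | pred n ih =>
    intro x
    have := step (x + (-(n : ℤ) - 1) • unitVec κ)
    rw [add_assoc, ← add_one_zsmul] at this
    simp only [sub_add_cancel] at this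
    rw [← this, ih]

/-- On `ℤ^d`, `dz g = 0 → g x = g 0` (the lattice is connected by unit steps). [folklore] -/
theorem const_of_dz_eq_zero {R : Type*} [CommRing R] (g : Form0 d R) (h : dz g = 0) (x : AffineAveraging.Site d) :
    g x = g 0 := by
  have aux : ∀ s : Finset (Fin d), g (∑ κ ∈ s, x κ • unitVec κ) = g 0 := by
    intro s
    induction s using Finset.induction_on with
    | empty => simp
    | insert a s ha ih =>
      rw [Finset.sum_insert ha, add_comm, apply_add_zsmul_unitVec_of_dz_eq_zero g h a _ _, ih]
  have hx : x = ∑ κ ∈ Finset.univ, x κ • unitVec κ := by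
    conv_lhs => rw [← Finset.univ_sum_single x]
    refine Finset.sum_congr rfl fun κ _ => ?_
    rw [unitVec, ← Pi.single_smul', smul_eq_mul, mul_one]
  rw [hx]; exact aux _

/-- **(B3-loc)(i)**: if the gradient `dz f` of a real lattice field is `N`-periodic (`N ≠ 0`), then `f` is an `N`-periodic
field plus a `ℤ`-linear one: `f x = p x + Σ_κ x_κ · m_κ`. [folklore] -/
theorem exists_periodic_add_linear_of_dz_periodic [NeZero N] (f : Form0 d ℝ)
    (hper : ∀ (κ : Fin d) (x a : AffineAveraging.Site d), dz f κ (x + (N : ℤ) • a) = dz f κ x) :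
    ∃ (m : Fin d → ℝ) (p : Form0 d ℝ), IsPeriodic N p ∧ ∀ x, f x = p x + ∑ κ, (x κ : ℝ) * m κ := by
  -- the block-translation defects are constants
  set c : AffineAveraging.Site d → ℝ := fun a => f ((N : ℤ) • a) - f 0 with hc
  have hconst : ∀ a x, f (x + (N : ℤ) • a) - f x = c a := by
    intro a x
    have hz : dz (fun x => f (x + (N : ℤ) • a) - f x) = 0 := by
      funext κ x
      simp only [dz, Pi.zero_apply]
      have := hper κ x a
      simp only [dz] at this
      rw [add_right_comm] at this
      linarith
    have := const_of_dz_eq_zero _ hz x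
    simpa [hc] using this
  -- `c` is additive
  have hadd : ∀ a b, c (a + b) = c a + c b := by
    intro a b
    have h1 := hconst b ((N : ℤ) • a)
    rw [← smul_add] at h1
    simp only [hc] at h1 ⊢
    linarith
  have hc0 : c 0 = 0 := by simp [hc]
  let C : AffineAveraging.Site d →+ ℝ := { toFun := c, map_zero' := hc0, map_add' := hadd }
  have hsum : ∀ a : AffineAveraging.Site d, c a = ∑ κ, (a κ : ℝ) * c (unitVec κ) := by
    intro a
    have : c a = C (∑ κ ∈ Finset.univ, Pi.single κ (a κ)) := by rw [Finset.univ_sum_single a]; rfl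
    rw [this, map_sum]
    refine Finset.sum_congr rfl fun κ _ => ?_
    have hκ : (Pi.single κ (a κ) : AffineAveraging.Site d) = a κ • unitVec κ := by
      rw [unitVec, ← Pi.single_smul', smul_eq_mul, mul_one]
    rw [hκ, map_zsmul, zsmul_eq_mul]; rfl
  have hN : (N : ℝ) ≠ 0 := Nat.cast_ne_zero.2 (NeZero.ne N)
  refine ⟨fun κ => c (unitVec κ) / N, fun x => f x - ∑ κ, (x κ : ℝ) * (c (unitVec κ) / N), ?_, ?_⟩
  · intro x a
    have h1 := hconst a x
    rw [hsum a] at h1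
    have h2 : ∑ κ, ((x + (N : ℤ) • a) κ : ℝ) * (c (unitVec κ) / N)
        = ∑ κ, (x κ : ℝ) * (c (unitVec κ) / N) + ∑ κ, (a κ : ℝ) * c (unitVec κ) := by
      rw [← Finset.sum_add_distrib]
      refine Finset.sum_congr rfl fun κ _ => ?_
      simp only [Pi.add_apply, Pi.smul_apply, smul_eq_mul, Int.cast_add, Int.cast_mul, Int.cast_natCast]
      rw [add_mul, mul_comm (N : ℝ) (a κ : ℝ), mul_assoc, mul_div_cancel₀ _ hN]
    beta_reduce
    rw [h2]; linarith
  · intro x; beta_reduce; ring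

end Literature.MathematicalPhysics.QuantumFieldTheory.Balaban1983to89.Beta.PeriodicDescent
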